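import Mathlib
import Literature.MathematicalPhysics.QuantumFieldTheory.MirrorRPKernel
import Literature.Analysis.Fourier.PosDefFunctionRieszPairing
import HarnessLib

/-!
# Crux `PrecisionLaplacian.StableConeRPRigidity` (stmt-CriticalPhenomena-4800), line `entire-profile-null-growth`:
# stub `stub_probedXRayRP` — S5 · reflection positivity of the axially probed X-ray

For a kernel `K : ℝ³ → ℝ` continuous off the origin, homogeneous of degree `-β`, mirror
reflection positive (`Literature.MathematicalPhysics.QuantumFieldTheory.IsMirrorRPKernel n K`) for
a normal `n` orthogonal to the lattice axis `eᵢ = EuclideanSpace.single i 1`, and exponents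
`0 < δ < 1 < β + δ`, the **probed X-ray kernel** `v ↦ ∫ K(v + s eᵢ) |s|^{-δ} ds` satisfies the
mirror-RP inequality `∑ c_a c_b ∫ K(p_a - θ_n p_b + s eᵢ)|s|^{-δ} ds ≥ 0` on every finite
configuration `p_a` in the open half-space `⟪p_a, n⟫ > 0`.

Proof. Fix the configuration and put `g(s) := ∑_{a,b} c_a c_b K(p_a - θ_n p_b + s eᵢ)`.
* `θ_n eᵢ = eᵢ` and `⟪p_a + s eᵢ, n⟫ = ⟪p_a, n⟫ > 0`, so RP of `K` on the shifted configurations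
  `(a, j) ↦ p_a + s_j eᵢ` with weights `c_a w_j` (`IsMirrorRPKernel.sum_nonneg`) says exactly that
  `g` is **positive-definite with real coefficients**: `∑ w_j w_l g(s_j - s_l) ≥ 0`;
* `p_a - θ_n p_b + s eᵢ` has normal component `⟪p_a, n⟫ + ⟪p_b, n⟫ > 0`, so it avoids the origin:
  `g` is continuous, and each `K(p_a - θ_n p_b + s eᵢ)|s|^{-δ}` is integrable — locally since
  `δ < 1`, at infinity since `|K(x)| ≤ M‖x‖^{-β}` (homogeneity + continuity on the unit sphere)
  gives `O((1 + |s|)^{-(β+δ)})` with `β + δ > 1` (`probedXRay_integrable`);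
* hence `∑ c_a c_b ∫ … = ∫ g(s)|s|^{-δ} ds ≥ 0` by
  `Literature.Analysis.Fourier.integral_mul_abs_rpow_neg_nonneg` (a continuous real
  positive-definite function pairs nonnegatively with `|s|^{-δ}`: Riemann sums give
  `∫ g (t - |s|)₊ ≥ 0`, and `|s|^{-δ} = δ(δ+1)∫₀^∞ (t - |s|)₊ t^{-(δ+2)} dt`).
The positivity hypothesis `K > 0` of the registered statement is not needed.
-/


open MeasureTheory
open scoped BigOperators InnerProductSpace

namespace Summit.CriticalPhenomena.Ising3DConformalLimit.Cruxes.StableConeRPRigidity.EntireProfileNullGrowth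

open Literature.MathematicalPhysics.QuantumFieldTheory

/-- A kernel continuous off the origin and homogeneous of degree `-β` is bounded by
`M ‖x‖^{-β}` (`M` = its maximum on the unit sphere). -/
theorem probedXRay_exists_bound {β : ℝ} {K : EuclideanSpace ℝ (Fin 3) → ℝ}
    (hK : ContinuousOn K {0}ᶜ) (hhom : ∀ c : ℝ, 0 < c → ∀ x, K (c • x) = c ^ (-β) * K x) :
    ∃ M, 0 ≤ M ∧ ∀ x, x ≠ 0 → |K x| ≤ M * ‖x‖ ^ (-β) := by
  obtain ⟨M, hM⟩ := (isCompact_sphere (0 : EuclideanSpace ℝ (Fin 3)) 1).exists_bound_of_continuousOn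
    (hK.mono fun x hx => by
      simp only [Set.mem_compl_iff, Set.mem_singleton_iff]
      rintro rfl
      simp at hx)
  refine ⟨max M 0, le_max_right _ _, fun x hx => ?_⟩
  have hnx : 0 < ‖x‖ := norm_pos_iff.2 hx
  have hu : ‖x‖⁻¹ • x ∈ Metric.sphere (0 : EuclideanSpace ℝ (Fin 3)) 1 := by
    simp [norm_smul, inv_mul_cancel₀ hnx.ne']
  have h := hhom ‖x‖ hnx (‖x‖⁻¹ • x)
  rw [smul_smul, mul_inv_cancel₀ hnx.ne', one_smul] at h
  have hMu := hM _ hu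
  rw [Real.norm_eq_abs] at hMu
  rw [h, abs_mul, abs_of_nonneg (Real.rpow_nonneg hnx.le _), mul_comm]
  exact mul_le_mul_of_nonneg_right (hMu.trans (le_max_left _ _)) (Real.rpow_nonneg hnx.le _)

/-- `|s|^{-δ}` is interval integrable on every bounded interval for `δ < 1`. -/
theorem probedXRay_intervalIntegrable_abs_rpow {δ : ℝ} (hδ1 : δ < 1) (a b : ℝ) :
    IntervalIntegrable (fun s : ℝ => |s| ^ (-δ)) volume a b := by
  suffices h : ∀ c : ℝ, IntervalIntegrable (fun s : ℝ => |s| ^ (-δ)) volume 0 c from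
    (h a).symm.trans (h b)
  have hpos : ∀ c : ℝ, 0 ≤ c → IntervalIntegrable (fun s : ℝ => |s| ^ (-δ)) volume 0 c := by
    intro c hc
    refine (intervalIntegral.intervalIntegrable_rpow' (by linarith : -1 < -δ)).congr_ae ?_
    rw [Set.uIoc_of_le hc]
    filter_upwards [ae_restrict_mem measurableSet_Ioc] with s hs
    rw [abs_of_pos hs.1]
  intro c
  rcases le_total 0 c with hc | hc
  · exact hpos c hc
  · have h := (hpos (-c) (by linarith)).comp_sub_left 0
    simpa using h

/-- The probed X-ray integrand `s ↦ K(v + s e) |s|^{-δ}` is integrable when `v + s e` avoids the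
origin, `‖e‖ = 1`, `0 < δ < 1 < β + δ`: locally (`K ∘ (v + · e)` continuous, `|s|^{-δ}` locally
integrable) and at infinity (`O((1 + |s|)^{-(β+δ)})`). -/
theorem probedXRay_integrable {β δ : ℝ} {K : EuclideanSpace ℝ (Fin 3) → ℝ}
    {v e : EuclideanSpace ℝ (Fin 3)} (hδ : 0 < δ) (hδ1 : δ < 1) (hβδ : 1 < β + δ)
    (hK : ContinuousOn K {0}ᶜ) (hhom : ∀ c : ℝ, 0 < c → ∀ x, K (c • x) = c ^ (-β) * K x)
    (hve : ∀ s : ℝ, v + s • e ≠ 0) (he : ‖e‖ = 1) :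
    Integrable (fun s : ℝ => K (v + s • e) * |s| ^ (-δ)) := by
  obtain ⟨M, hM0, hM⟩ := probedXRay_exists_bound hK hhom
  have hβ : 0 < β := by linarith
  have hcont : Continuous fun s : ℝ => K (v + s • e) :=
    hK.comp_continuous (by fun_prop) fun s => hve s
  -- local integrability
  have hloc : LocallyIntegrable (fun s : ℝ => K (v + s • e) * |s| ^ (-δ)) := by
    have h1 : LocallyIntegrable (fun s : ℝ => |s| ^ (-δ)) := by
      rw [locallyIntegrable_iff]
      intro k hk
      obtain ⟨R, hR0, hR⟩ := hk.isBounded.subset_closedBall_lt 0 0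
      rw [Real.closedBall_eq_Icc, zero_sub, zero_add] at hR
      exact ((intervalIntegrable_iff_integrableOn_Icc_of_le (by linarith : -R ≤ R)).1
        (probedXRay_intervalIntegrable_abs_rpow hδ1 (-R) R)).mono_set hR
    rw [← locallyIntegrableOn_univ] at h1 ⊢
    exact h1.continuousOn_mul hcont.continuousOn isOpen_univ.isLocallyClosed
  -- decay at infinity
  refine hloc.integrable_of_isBigO_cocompact (g := fun s : ℝ => (1 + ‖s‖) ^ (-(β + δ))) ?_
    ((integrable_one_add_norm ?_).integrableAtFilter _)
  swap
  · simpa using hβδ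
  refine Asymptotics.IsBigO.of_bound (M * 2 ^ (β + δ)) ?_
  have hmem : {s : ℝ | 2 * ‖v‖ + 1 ≤ |s|} ∈ Filter.cocompact ℝ := by
    rw [Filter.mem_cocompact]
    refine ⟨Metric.closedBall 0 (2 * ‖v‖ + 1), isCompact_closedBall _ _, fun s hs => ?_⟩
    simp only [Set.mem_compl_iff, Metric.mem_closedBall, dist_zero_right, Real.norm_eq_abs,
      not_le] at hs
    exact hs.le
  filter_upwards [hmem] with s hs
  have hs1 : 1 ≤ |s| := by linarith [norm_nonneg v, hs]
  set u : ℝ := (1 + |s|) / 2 with hu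
  have hu0 : 0 < u := by positivity
  have hus : u ≤ |s| := by rw [hu]; linarith
  have hnorm : u ≤ ‖v + s • e‖ := by
    have h3 : ‖s • e‖ ≤ ‖v + s • e‖ + ‖v‖ := by
      calc ‖s • e‖ = ‖(v + s • e) - v‖ := by rw [add_sub_cancel_left]
        _ ≤ ‖v + s • e‖ + ‖v‖ := norm_sub_le _ _
    rw [norm_smul, he, mul_one, Real.norm_eq_abs] at h3
    rw [hu]; linarith [hs]
  have hK1 : |K (v + s • e)| ≤ M * u ^ (-β) :=
    (hM _ (hve s)).trans (mul_le_mul_of_nonneg_left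
      (Real.rpow_le_rpow_of_nonpos hu0 hnorm (by linarith)) hM0)
  have hs2 : |s| ^ (-δ) ≤ u ^ (-δ) := Real.rpow_le_rpow_of_nonpos hu0 hus (by linarith)
  have hrhs : M * u ^ (-β) * u ^ (-δ) = M * 2 ^ (β + δ) * (1 + |s|) ^ (-(β + δ)) := by
    rw [mul_assoc, ← Real.rpow_add hu0, show -β + -δ = -(β + δ) by ring, hu,
      Real.div_rpow (by positivity) (by norm_num), Real.rpow_neg (by norm_num : (0:ℝ) ≤ 2),
      div_inv_eq_mul]
    ring
  rw [norm_mul, Real.norm_eq_abs, Real.norm_eq_abs, Real.norm_eq_abs, Real.norm_eq_abs,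
    abs_of_nonneg (Real.rpow_nonneg (abs_nonneg s) _),
    abs_of_nonneg (Real.rpow_nonneg (by positivity) _), ← hrhs]
  exact mul_le_mul hK1 hs2 (Real.rpow_nonneg (abs_nonneg _) _) (by positivity)

/-- Registered stub `stub_probedXRayRP` — **S5 · reflection positivity of the axially probed X-ray**.
For a kernel `K` continuous off the origin, homogeneous of degree `-β`, mirror-RP for a normal `n`
orthogonal to the lattice axis `eᵢ`, and `0 < δ < 1 < β + δ`: the probed X-ray kernel
`v ↦ ∫ K(v + s eᵢ) |s|^{-δ} ds` satisfies the mirror-RP inequality on every finite configuration in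
the open half-space. Proof: for a configuration `(p_a, c_a)` the function
`g(s) = ∑ c_a c_b K(p_a - θ p_b + s eᵢ)` is continuous and positive-definite on `ℝ` (RP of `K` on
the shifted configurations `p_a + s_j eᵢ`, which stay in the half-space since `eᵢ ⊥ n`, and
`θ eᵢ = eᵢ`), and `g |s|^{-δ}` is integrable; conclude by
`Literature.Analysis.Fourier.integral_mul_abs_rpow_neg_nonneg` (Fejér triangles are pairings of
smeared configurations, `|s|^{-δ}` is a positive mixture of triangles). -/
theorem stub_probedXRayRP :
    ∀ (β δ : ℝ) (K : EuclideanSpace ℝ (Fin 3) → ℝ) (i : Fin 3) (n : EuclideanSpace ℝ (Fin 3)),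
      0 < δ → δ < 1 → 1 < β + δ →
      ContinuousOn K {0}ᶜ → (∀ x, x ≠ 0 → 0 < K x) →
      (∀ c : ℝ, 0 < c → ∀ x, K (c • x) = c ^ (-β) * K x) →
      Literature.MathematicalPhysics.QuantumFieldTheory.IsMirrorRPKernel n K →
      inner ℝ n (EuclideanSpace.single i (1:ℝ)) = 0 →
      ∀ (m : ℕ) (p : Fin m → EuclideanSpace ℝ (Fin 3)) (c : Fin m → ℝ), (∀ a, 0 < inner ℝ (p a) n) →
        0 ≤ ∑ a, ∑ b, c a * c b *
          ∫ s : ℝ, K (p a - ((ℝ ∙ n)ᗮ).reflection (p b) + s • EuclideanSpace.single i (1:ℝ)) * |s| ^ (-δ) := by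
  intro β δ K i n hδ hδ1 hβδ hK _ hhom hRP hn m p c hp
  set e : EuclideanSpace ℝ (Fin 3) := EuclideanSpace.single i (1:ℝ) with he_def
  have he1 : ‖e‖ = 1 := by simp [he_def]
  have hen : ⟪e, n⟫_ℝ = 0 := by rw [real_inner_comm]; exact hn
  have hθe : (ℝ ∙ n)ᗮ.reflection e = e := mirrorReflection_of_inner_eq_zero hen
  -- the shifted differences stay away from the origin
  have hve : ∀ (a b : Fin m) (s : ℝ), p a - (ℝ ∙ n)ᗮ.reflection (p b) + s • e ≠ 0 := by
    intro a b s h0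
    have h1 : ⟪p a - (ℝ ∙ n)ᗮ.reflection (p b) + s • e, n⟫_ℝ =
        ⟪p a - (ℝ ∙ n)ᗮ.reflection (p b), n⟫_ℝ := by
      rw [inner_add_left, real_inner_smul_left, hen, mul_zero, add_zero]
    have h2 := inner_sub_mirrorReflection_normal_pos (hp a) (hp b)
    rw [← h1, h0, inner_zero_left] at h2
    exact lt_irrefl _ h2
  have hcont : ∀ a b : Fin m,
      Continuous fun s : ℝ => K (p a - (ℝ ∙ n)ᗮ.reflection (p b) + s • e) :=
    fun a b => hK.comp_continuous (by fun_prop) fun s => hve a b s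
  have hint : ∀ a b : Fin m, Integrable
      (fun s : ℝ => K (p a - (ℝ ∙ n)ᗮ.reflection (p b) + s • e) * |s| ^ (-δ)) :=
    fun a b => probedXRay_integrable hδ hδ1 hβδ hK hhom (hve a b) he1
  -- the positive-definite function `g`
  set g : ℝ → ℝ := fun s => ∑ a, ∑ b, c a * c b * K (p a - (ℝ ∙ n)ᗮ.reflection (p b) + s • e)
    with hg_def
  have hg : Continuous g :=
    continuous_finsetSum _ fun a _ => continuous_finsetSum _ fun b _ =>
      continuous_const.mul (hcont a b)
  have hpd : ∀ (N : ℕ) (s w : Fin N → ℝ), 0 ≤ ∑ j, ∑ l, w j * w l * g (s j - s l) := by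
    intro N s w
    have h := hRP.sum_nonneg (fun q : Fin m × Fin N => p q.1 + s q.2 • e)
      (fun q => c q.1 * w q.2) fun q => by
        show 0 < ⟪p q.1 + s q.2 • e, n⟫_ℝ
        rw [inner_add_left, real_inner_smul_left, hen, mul_zero, add_zero]
        exact hp q.1
    have key : ∀ (a b : Fin m) (σ τ : ℝ), p a + σ • e - (ℝ ∙ n)ᗮ.reflection (p b + τ • e) =
        p a - (ℝ ∙ n)ᗮ.reflection (p b) + (σ - τ) • e := by
      intro a b σ τ
      rw [map_add, LinearIsometryEquiv.map_smul, hθe, sub_smul]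
      abel
    simp only [key, Fintype.sum_prod_type_right] at h
    refine h.trans_eq (Finset.sum_congr rfl fun j _ => ?_)
    rw [Finset.sum_comm]
    refine Finset.sum_congr rfl fun l _ => ?_
    simp only [hg_def, Finset.mul_sum]
    exact Finset.sum_congr rfl fun a _ => Finset.sum_congr rfl fun b _ => by ring
  -- integrability of `g |s|^{-δ}` and the conclusion
  have hexp : ∀ s : ℝ, g s * |s| ^ (-δ) =
      ∑ a, ∑ b, c a * c b * (K (p a - (ℝ ∙ n)ᗮ.reflection (p b) + s • e) * |s| ^ (-δ)) := by
    intro s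
    simp only [hg_def, Finset.sum_mul]
    exact Finset.sum_congr rfl fun a _ => Finset.sum_congr rfl fun b _ => by ring
  have hgint : Integrable (fun s => g s * |s| ^ (-δ)) := by
    rw [show (fun s => g s * |s| ^ (-δ)) = fun s => ∑ a, ∑ b,
        c a * c b * (K (p a - (ℝ ∙ n)ᗮ.reflection (p b) + s • e) * |s| ^ (-δ)) from funext hexp]
    exact integrable_finsetSum _ fun a _ => integrable_finsetSum _ fun b _ =>
      (hint a b).const_mul _
  have hfinal := Literature.Analysis.Fourier.integral_mul_abs_rpow_neg_nonneg hg hpd hδ hgint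
  refine hfinal.trans_eq ?_
  rw [integral_congr_ae (Filter.Eventually.of_forall hexp),
    integral_finsetSum _ (fun a _ => integrable_finsetSum _ fun b _ => (hint a b).const_mul _)]
  refine Finset.sum_congr rfl fun a _ => ?_
  rw [integral_finsetSum _ (fun b _ => (hint a b).const_mul _)]
  refine Finset.sum_congr rfl fun b _ => ?_
  exact MeasureTheory.integral_const_mul _ _

end Summit.CriticalPhenomena.Ising3DConformalLimit.Cruxes.StableConeRPRigidity.EntireProfileNullGrowth
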